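import Summits.BirchSwinnertonDyer.BirchSwinnertonDyer.Theses.ResidualThetaTransportAtTwo
import Summits.BirchSwinnertonDyer.BirchSwinnertonDyer.Theorems.ResidualThetaTransportAtTwoSignedMuVanishingAtTwoPlusFlatLayer
import Summits.BirchSwinnertonDyer.BirchSwinnertonDyer.Theorems.ResidualThetaTransportAtTwoThetaLayerLambdaCongruenceAtTwoDoubling
import Summits.BirchSwinnertonDyer.BirchSwinnertonDyer.Theorems.ResidualThetaTransportAtTwoThetaLayerLambdaCongruenceAtTwoSupNormIsometry
import HarnessLib

/-!
# Route `ResidualThetaTransportAtTwo`, crux Kμ⁺ `SignedMuVanishingAtTwoPlus` (stmt-BirchSwinnertonDyer-20689),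
# line `birth` v3, stub `stub_flatMuZeroAtTwo`: the flat residue from ONE DEPLETED even layer —
# `μ_n(θ_n^{S₀}(f)) = 0` (the route's `S₀`-depleted Mazur–Tate element, reduced mod `(X+1)^{2ⁿ} − 1`) ⇒ `2 ∤ L♭`

Cell `bsd-wall`, width seat `bsd-wall-rtt-p4-w3` (helper; THEOREMS ONLY — no `def`, no named fact, no `sorry`;
nothing about any curve is asserted; BSD is not proved by this). Companion of
`…SignedMuVanishingAtTwoPlusFlatLayer` (FLAT-at-`(W,f)` ⟺ one even layer `θ_n(f)` with `μ_n = 0`).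

The route's cruxes 20688 `ThetaLayerLambdaCongruenceAtTwo` / 20787 `ResidualThetaMainConjectureAtTwo` and the
cell's layer tables (D-rtt-1: `μ_n(θ_n^{S₀}) = 0` at `n = 6, 8` on both sides of 90/90 congruent cells) work with
the `S₀`-DEPLETED element `Θ_n^{S₀}(f) = (θ_n(f) · ∏_{v ∈ S₀} P_v(ℓ_v⁻¹(X+1)^{e_{v,n}})) mod ((X+1)^{2ⁿ} − 1)`
read in `ℚ̄₂[X]`. Depletion and reduction can only LOWER the layer sup-norm (Gauss's lemma `supNorm_mul'`,
integral Euler factors, `supNorm_modByMonic_le` for the integral monic layer modulus — all kernel theorems of the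
sibling crux's seats rtt-p3/rtt-p3-w2, consumed BY NAME), while a Pollack pair at `2` bounds
`‖θ_n(f)‖_sup ≤ 2^{−μ(L⁻)}` (`ResidualThetaLayer.supNorm_mazurTateElement_two_le`, seat rtt-p2). Hence:

* §1 `supNorm_map_intCast_le_one`, `supNorm_layerEulerFactorW_le_one`, `supNorm_layerEulerProductW_le_one` — the
  `W`-side depletion factors `P_v(ℓ_v⁻¹(X+1)^e)` (`P_v ∈ ℤ[X]` the local polynomial, `ℓ_v` odd) are integral;
* §2 `not_two_dvd_flat_of_one_le_supNorm_mul_modByMonic` — for ANY integral multiplier `E` and ANY integral monic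
  modulus `ω`: `‖(θ_n(f)·E) %ₘ ω‖_sup ≥ 1` at an even `n` ⇒ `2 ∤ L⁻` for every Pollack pair;
* §3 `not_two_dvd_flat_of_one_le_supNorm_depletedLayerW` — the route's depleted element VERBATIM (the `W`-side
  term of `ThetaLayerLambdaCongruenceAtTwo`, any `S₀` off `2`, any even `n`): `μ_n(Θ_n^{S₀}(f)) = 0` ⇒ `2 ∤ L⁻`;
  `flatAtTwo_of_one_le_supNorm_depletedLayerW` — hence FLAT-at-`(W,f)` on the habitat from ONE depleted even layer
  (the kernel door from the D-rtt-1 / ENGINE-2 column `μ(θ_n^{S₀}) = 0` to the stub, up to the tables' period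
  normalisation), and `supNorm_depletedLayerW_le` — conversely the depleted sup-norm never exceeds `2^{−μ(L⁻)}`.

References: R. Pollack, Duke Math. J. 118 (2003) Prop. 6.18 [Pollack2003]; R. Pollack, T. Weston, Duke Math. J. 156
(2011) §3.1, Rem. 2.2 [PollackWeston2011MT]; R. Greenberg, V. Vatsal, Invent. Math. 142 (2000) §1–§2
[GreenbergVatsal2000].
-/

set_option autoImplicit false
set_option linter.dupNamespace false

noncomputable section

open scoped Classical MatrixGroups ModularForm

open CongruenceSubgroup Polynomial WeierstrassCurve NumberField IsDedekindDomain
  Literature.NumberTheory.EllipticCurves Literature.NumberTheory.EllipticCurves.ModularForms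
  Literature.NumberTheory.EllipticCurves.Rank1Residual Literature.NumberTheory.EllipticCurves.GreenbergVatsal2000
  Literature.NumberTheory.IwasawaTheory Summit.BirchSwinnertonDyer.Rank1Residual.Supersingular
  Summit.BirchSwinnertonDyer.Rank1Residual.X1
  Summit.BirchSwinnertonDyer.BirchSwinnertonDyer.Theorems.ThetaLayerLambdaCongruenceAtTwo

namespace Summit.BirchSwinnertonDyer.BirchSwinnertonDyer.Theorems.SignedMuAtTwo

/-! ## §1. The `W`-side depletion factors are integral -/

section Euler

/-- An integer polynomial read in `ℚ̄₂[X]` has sup-norm `≤ 1`. [folklore] -/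
theorem supNorm_map_intCast_le_one (P : ℤ[X]) : (P.map (Int.castRingHom (PadicAlgCl 2))).supNorm ≤ 1 := by
  refine supNorm_le_of_forall_coeff_le fun j ↦ ?_
  rw [coeff_map, eq_intCast, ← map_intCast (algebraMap ℚ_[2] (PadicAlgCl 2)), norm_algebraMap']
  exact Padic.norm_int_le_one _

variable (W : WeierstrassCurve ℚ)

/-- **The depletion factor `P_v(ℓ_v⁻¹ (X+1)^e)` of `W` at a place `v ∤ 2` is integral**: `P_v ∈ ℤ[X]`
(`WeierstrassCurve.localPolynomialAt`), `‖ℓ_v⁻¹‖₂ = 1`, `‖X + 1‖_sup ≤ 1`.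
[cite: GreenbergVatsal2000, §1 (the non-primitive Euler factors; integrality)] -/
theorem supNorm_layerEulerFactorW_le_one {v : HeightOneSpectrum (𝓞 ℚ)} (hv : ((2 : ℕ) : 𝓞 ℚ) ∉ v.asIdeal)
    (e : ℕ) :
    (((W.localPolynomialAt v).map (Int.castRingHom (PadicAlgCl 2))).comp
      (C ((Rat.HeightOneSpectrum.natGenerator v : PadicAlgCl 2)⁻¹) * (X + 1) ^ e)).supNorm ≤ 1 := by
  apply supNorm_comp_le_one (supNorm_map_intCast_le_one _)
  rw [supNorm_C_mul, norm_inv, norm_natCast_padicAlgCl_two_eq_one (not_two_dvd_natGenerator hv), inv_one, one_mul]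
  exact supNorm_pow_le_one supNorm_X_add_one_le e

/-- The `W`-side depletion PRODUCT over a finite set `S₀` of places off `2` is integral. [cite: GreenbergVatsal2000, §1] -/
theorem supNorm_layerEulerProductW_le_one {S₀ : Finset (HeightOneSpectrum (𝓞 ℚ))}
    (hS : ∀ v ∈ S₀, ((2 : ℕ) : 𝓞 ℚ) ∉ v.asIdeal) (e : HeightOneSpectrum (𝓞 ℚ) → ℕ) :
    (∏ v ∈ S₀, ((W.localPolynomialAt v).map (Int.castRingHom (PadicAlgCl 2))).comp
      (C ((Rat.HeightOneSpectrum.natGenerator v : PadicAlgCl 2)⁻¹) * (X + 1) ^ e v)).supNorm ≤ 1 :=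
  supNorm_prod_le_one _ _ fun v hv ↦ supNorm_layerEulerFactorW_le_one W (hS v hv) (e v)

end Euler

/-! ## §2. Depletion and reduction only lower the sup-norm: one depleted even layer with `μ_n = 0` ⇒ `2 ∤ L⁻` -/

section Depleted

variable {N : ℕ} (f : CuspForm (Gamma0 N) 2) {Lplus Lminus : IwasawaAlgebra 2}

/-- **`‖(θ_n(f)·E) %ₘ ω‖_sup ≤ 2^{−μ(L⁻)}`** for an even layer `n`, any integral multiplier `E` and any integral
monic modulus `ω`. [cite: Pollack2003, Prop. 6.18] [cite: PollackWeston2011MT, §3.1] -/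
theorem supNorm_mul_modByMonic_mazurTateElement_le (hP : IsPollackPair f 2 Lplus Lminus) {n : ℕ} (hn : Even n)
    {E ω : (PadicAlgCl 2)[X]} (hE : E.supNorm ≤ 1) (hω : ω.Monic) (hω1 : ω.supNorm ≤ 1) :
    (((mazurTateElement f 2 n).map (algebraMap ℚ (PadicAlgCl 2)) * E) %ₘ ω).supNorm ≤
      (2 : ℝ)⁻¹ ^ MuLambda.mu Lminus := by
  refine (supNorm_modByMonic_le hω hω1 _).trans ?_
  rw [supNorm_mul']
  exact (mul_le_of_le_one_right (supNorm_nonneg _) hE).trans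
    (ResidualThetaLayer.supNorm_mazurTateElement_two_le f hP hn)

/-- **One depleted even layer with `μ_n = 0` certifies `2 ∤ L⁻`**: if `‖(θ_n(f)·E) %ₘ ω‖_sup ≥ 1` for some even
`n`, an integral `E` and an integral monic `ω`, then `2 ∤ L⁻` for the Pollack pair.
[cite: Pollack2003, Prop. 6.18] [cite: PollackWeston2011MT, §3.1] -/
theorem not_two_dvd_flat_of_one_le_supNorm_mul_modByMonic (hP : IsPollackPair f 2 Lplus Lminus) {n : ℕ}
    (hn : Even n) {E ω : (PadicAlgCl 2)[X]} (hE : E.supNorm ≤ 1) (hω : ω.Monic) (hω1 : ω.supNorm ≤ 1)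
    (h1 : 1 ≤ (((mazurTateElement f 2 n).map (algebraMap ℚ (PadicAlgCl 2)) * E) %ₘ ω).supNorm) :
    ¬ PowerSeries.C (2 : ℤ_[2]) ∣ Lminus := by
  have hle := h1.trans (supNorm_mul_modByMonic_mazurTateElement_le f hP hn hE hω hω1)
  have hμ : MuLambda.mu Lminus = 0 := by
    by_contra hne
    exact absurd hle (not_le.mpr (pow_lt_one₀ (by norm_num) (by norm_num) hne))
  have h := (mu_eq_zero_iff_not_C_dvd (p := 2) hP.2.1).mp hμ
  simpa using h

end Depleted

/-! ## §3. The route's `S₀`-depleted layer element of `W` -/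

section Route

variable {W : WeierstrassCurve ℚ} {N : ℕ} (f : CuspForm (Gamma0 N) 2) {Lplus Lminus : IwasawaAlgebra 2}

/-- **`‖Θ_n^{S₀}(f)‖_sup ≤ 2^{−μ(L⁻)}`** for the route's depleted element of `W` (the `W`-side term of
`ThetaLayerLambdaCongruenceAtTwo` / `ResidualThetaMainConjectureAtTwo`, verbatim), every `S₀` off `2`, every even `n`.
[cite: Pollack2003, Prop. 6.18] [cite: PollackWeston2011MT, §3.1] [cite: GreenbergVatsal2000, §2] -/
theorem supNorm_depletedLayerW_le (hP : IsPollackPair f 2 Lplus Lminus) {n : ℕ} (hn : Even n)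
    {S₀ : Finset (HeightOneSpectrum (𝓞 ℚ))} (hS : ∀ v ∈ S₀, ((2 : ℕ) : 𝓞 ℚ) ∉ v.asIdeal) :
    (((mazurTateElement f 2 n).map (algebraMap ℚ (PadicAlgCl 2)) *
        ∏ v ∈ S₀, ((W.localPolynomialAt v).map (Int.castRingHom (PadicAlgCl 2))).comp
          (C ((Rat.HeightOneSpectrum.natGenerator v : PadicAlgCl 2)⁻¹) *
            (X + 1) ^ (PadicInt.toZModPow n
              (-(frobeniusExponent 2 (Rat.HeightOneSpectrum.natGenerator v : ℤ_[2])))).val)) %ₘ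
        ((X + 1) ^ 2 ^ n - 1)).supNorm ≤ (2 : ℝ)⁻¹ ^ MuLambda.mu Lminus :=
  supNorm_mul_modByMonic_mazurTateElement_le f hP hn (supNorm_layerEulerProductW_le_one W hS _)
    (monic_layerModulus (p := 2) n) (supNorm_layerModulus_le_one (p := 2) n)

/-- **One depleted even layer of `W` with `μ_n(Θ_n^{S₀}(f)) = 0` certifies `2 ∤ L⁻`** (the route's depleted element
verbatim, any `S₀` off `2`). [cite: Pollack2003, Prop. 6.18] [cite: PollackWeston2011MT, §3.1] [cite: GreenbergVatsal2000, §2] -/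
theorem not_two_dvd_flat_of_one_le_supNorm_depletedLayerW (hP : IsPollackPair f 2 Lplus Lminus) {n : ℕ}
    (hn : Even n) {S₀ : Finset (HeightOneSpectrum (𝓞 ℚ))} (hS : ∀ v ∈ S₀, ((2 : ℕ) : 𝓞 ℚ) ∉ v.asIdeal)
    (h1 : 1 ≤ (((mazurTateElement f 2 n).map (algebraMap ℚ (PadicAlgCl 2)) *
        ∏ v ∈ S₀, ((W.localPolynomialAt v).map (Int.castRingHom (PadicAlgCl 2))).comp
          (C ((Rat.HeightOneSpectrum.natGenerator v : PadicAlgCl 2)⁻¹) *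
            (X + 1) ^ (PadicInt.toZModPow n
              (-(frobeniusExponent 2 (Rat.HeightOneSpectrum.natGenerator v : ℤ_[2])))).val)) %ₘ
        ((X + 1) ^ 2 ^ n - 1)).supNorm) :
    ¬ PowerSeries.C (2 : ℤ_[2]) ∣ Lminus :=
  not_two_dvd_flat_of_one_le_supNorm_mul_modByMonic f hP hn (supNorm_layerEulerProductW_le_one W hS _)
    (monic_layerModulus (p := 2) n) (supNorm_layerModulus_le_one (p := 2) n) h1

/-- **In `layerMu` currency**: a non-zero depleted even layer with Pollack–Weston `μ(Θ_n^{S₀}(f)) = 0` certifies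
`2 ∤ L⁻`. [cite: PollackWeston2011MT, §3.1] -/
theorem not_two_dvd_flat_of_layerMu_depletedLayerW_eq_zero (hP : IsPollackPair f 2 Lplus Lminus) {n : ℕ}
    (hn : Even n) {S₀ : Finset (HeightOneSpectrum (𝓞 ℚ))} (hS : ∀ v ∈ S₀, ((2 : ℕ) : 𝓞 ℚ) ∉ v.asIdeal)
    (hne : ((mazurTateElement f 2 n).map (algebraMap ℚ (PadicAlgCl 2)) *
        ∏ v ∈ S₀, ((W.localPolynomialAt v).map (Int.castRingHom (PadicAlgCl 2))).comp
          (C ((Rat.HeightOneSpectrum.natGenerator v : PadicAlgCl 2)⁻¹) *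
            (X + 1) ^ (PadicInt.toZModPow n
              (-(frobeniusExponent 2 (Rat.HeightOneSpectrum.natGenerator v : ℤ_[2])))).val)) %ₘ
        ((X + 1) ^ 2 ^ n - 1) ≠ 0)
    (h0 : layerMu 2 ((((mazurTateElement f 2 n).map (algebraMap ℚ (PadicAlgCl 2)) *
        ∏ v ∈ S₀, ((W.localPolynomialAt v).map (Int.castRingHom (PadicAlgCl 2))).comp
          (C ((Rat.HeightOneSpectrum.natGenerator v : PadicAlgCl 2)⁻¹) *
            (X + 1) ^ (PadicInt.toZModPow n
              (-(frobeniusExponent 2 (Rat.HeightOneSpectrum.natGenerator v : ℤ_[2])))).val)) %ₘ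
        ((X + 1) ^ 2 ^ n - 1))) = 0) :
    ¬ PowerSeries.C (2 : ℤ_[2]) ∣ Lminus :=
  not_two_dvd_flat_of_one_le_supNorm_depletedLayerW f hP hn hS ((layerMu_eq_zero_iff one_lt_two hne).mp h0).ge

/-- **FLAT-at-`(W, f)` from ONE depleted even layer** (for every Pollack pair at `2`; on the habitat a pair exists,
so this is the stub `stub_flatMuZeroAtTwo` at `W`): the kernel door from the cell's depleted-layer tables
(`μ_n(θ_n^{S₀}) = 0`) to the flat residue. [cite: Pollack2003, Prop. 6.18] [cite: PollackWeston2011MT, §3.1] -/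
theorem flatAtTwo_of_one_le_supNorm_depletedLayerW {n : ℕ} (hn : Even n) {S₀ : Finset (HeightOneSpectrum (𝓞 ℚ))}
    (hS : ∀ v ∈ S₀, ((2 : ℕ) : 𝓞 ℚ) ∉ v.asIdeal)
    (h1 : 1 ≤ (((mazurTateElement f 2 n).map (algebraMap ℚ (PadicAlgCl 2)) *
        ∏ v ∈ S₀, ((W.localPolynomialAt v).map (Int.castRingHom (PadicAlgCl 2))).comp
          (C ((Rat.HeightOneSpectrum.natGenerator v : PadicAlgCl 2)⁻¹) *
            (X + 1) ^ (PadicInt.toZModPow n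
              (-(frobeniusExponent 2 (Rat.HeightOneSpectrum.natGenerator v : ℤ_[2])))).val)) %ₘ
        ((X + 1) ^ 2 ^ n - 1)).supNorm) :
    ∀ Lplus Lminus : IwasawaAlgebra 2, IsPollackPair f 2 Lplus Lminus → ¬ PowerSeries.C (2 : ℤ_[2]) ∣ Lminus :=
  fun _ _ hP ↦ not_two_dvd_flat_of_one_le_supNorm_depletedLayerW f hP hn hS h1

end Route

end Summit.BirchSwinnertonDyer.BirchSwinnertonDyer.Theorems.SignedMuAtTwo

end
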